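import Summits.SmoothPoincare4.SmoothPoincare4.Theorems.ConvexBisectionAcyclicBisectionExistsBeltSlideLongitude
import HarnessLib

/-!
# Sliding the belt circle inside the handle, IV: the end framing read on the base piece
(node T3c-1 `node_belt_isotopic_pushoff` of the sub-goal T3 "the complement piece is the cap with the
DUAL handles" of stub `stub_steinRealisation` (NF6), line `modp-braid-orbits`, crux
`ConvexBisection.AcyclicBisectionExists`, item stmt-SmoothPoincare4-10508; wave 2, worker V6, lead c5)

Sequel of `…BeltSlideLongitude.lean` (`slideMap`, `slideLinkIsotopy`, `tubeLongitudePt`).  The handle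
framing of an attaching map is the velocity of the map along the arc `s ↦ (cos s θ, sin s, 0)` of
`∂D⁴` (`attachingFraming_eq_mfderiv_comp_tubeArcPt`); for the slid belt map at `t = 1` this arc, slid
to `R_{arcsin r} (σ (cos s θ, sin s, 0))`, is glued (`x ∼ h̄ α(x)`) to `h̄ᵢ` of the **glued framing
arc** `slideArcPt b r θ s = α (R_{arcsin r} (σ (cos s θ, sin s, 0))) ∈ T` near `s = 0`:

* §6 `slideArcPt` (total, junk off a neighbourhood of `s = 0`), `lamSq_slideArcPt_ne_one`,
  `coe_coe_slideArcPt(_of_lt)`, `slideArcPt_zero = tubeLongitudePt`,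
  `eventually_lamSq_slideInner_tubeArcPt_ne_zero`, `jB_slideInner_tubeArcPt` (the glued pair along
  the arc), **`attachingFraming_slideMap_one`**: the end framing of the slide is the velocity
  `d/ds|₀ D.jA (h̄ᵢ (slideArcPt b r θ s))`, and `eventually_coe_coe_slideArcPt` (its explicit
  coordinates);
* §7 registered helper **`helper_belt_slide`**: the whole of stages 1–2 of T3c-1 in tree vocabulary
  — in `∂P`, the framed belt circles are link-isotopic, each inside its own handle, to the
  `D.jA ∘ h̄ᵢ`-images of the `r`-longitudes of the attaching circles, the belt framings carried by
  the handle framings of the slid belt maps, the end framing being the velocity of `D.jA ∘ h̄ᵢ` along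
  the explicit model arc.

What remains of T3c-1 after this file (stages 3–4, Lefschetz-specific): an isotopy in
`∂ Base g ∖ ⋃ cores` from this framed `r`-longitude to a framed page curve, with the shadow and
page-twisting bookkeeping (see the V6 report).  Everything here is proved; no named facts.

## References
* A. A. Kosinski, *Differential Manifolds*, Academic Press (1993), VI §6, (6.1). [Kosinski1993]
* J. Milnor, *Lectures on the h-cobordism theorem* (1965), §3 (dual handles). [MilnorHCobordism1965]
* R. C. Kirby, *The Topology of 4-Manifolds*, LNM 1374 (1989), Ch. I §2 (framings). [Kirby1989]
* R. E. Gompf, A. I. Stipsicz, *4-Manifolds and Kirby Calculus* (1999), §8.2. [GompfStipsicz1999]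
-/

noncomputable section

-- the prescribed namespace `Summit.<P>.<Sub>.…` duplicates `SmoothPoincare4` (P = Sub)
set_option linter.dupNamespace false

open scoped Manifold ContDiff Topology
open Set Function Metric Real

namespace Summit.SmoothPoincare4.SmoothPoincare4.Theorems.AcyclicBisectionExists.ModpBraidOrbits

open Literature.Topology.FourManifolds Literature.Topology.FourManifolds.HandleAttachingMap

/-! ### §6 The end framing read on the base piece: the glued framing arc -/

section Arc

/-- A fixed point `(1/2, 0, 0, 0)` of `T ∖ S` (junk value). [folklore] -/
def tubeJunkPt : ↥(handleTube 3 2) :=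
  ⟨⟨WithLp.toLp 2 ![1 / 2, 0, 0, 0], by
    rw [mem_closedBall_zero_iff]
    have e : ‖(WithLp.toLp 2 ![1 / 2, 0, 0, 0] : EuclideanSpace ℝ (Fin 4))‖ ^ 2 = 1 / 4 := by
      rw [EuclideanSpace.norm_sq_eq, Fin.sum_univ_four]
      simp only [Real.norm_eq_abs, sq_abs]
      simp; norm_num
    nlinarith [norm_nonneg (WithLp.toLp 2 ![1 / 2, 0, 0, 0] : EuclideanSpace ℝ (Fin 4))]⟩, by
    rw [mem_handleTube, lamSq_two_fin_four]
    norm_num⟩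

/-- `|x_λ|² = 1/4` at the junk point. [folklore] -/
theorem lamSq_tubeJunkPt :
    lamSq 2 (((tubeJunkPt : ↥(handleTube 3 2)) : closedBall (0 : EuclideanSpace ℝ (Fin 4)) 1) :
      EuclideanSpace ℝ (Fin 4)) = 1 / 4 := by
  show lamSq 2 (WithLp.toLp 2 ![1 / 2, 0, 0, 0]) = 1 / 4
  rw [lamSq_two_fin_four]; norm_num

open Classical in
/-- **The glued framing arc** `s ↦ α (G_{r,1} (cos s θ, sin s, 0))` in Kosinski's tube `T`: the
partner under `x ∼ h̄ α(x)` of the slid framing arc of the belt circle (junk where the slid arc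
meets the belt disc `x_λ = 0`). [cite: Kosinski1993, VI (6.1)] -/
def slideArcPt (b : Bool) (r : ℝ) (θ : sphere (0 : EuclideanSpace ℝ (Fin 2)) 1) (s : ℝ) : ↥(handleTube 3 2) :=
  if h0 : lamSq 2 (((slideInner b r 1 (tubeArcPt θ s) : ↥(beltPiece 3 2)) :
      closedBall (0 : EuclideanSpace ℝ (Fin 4)) 1) : EuclideanSpace ℝ (Fin 4)) ≠ 0 then
    handleInversionPt ((slideInner b r 1 (tubeArcPt θ s) : ↥(beltPiece 3 2)) :
      closedBall (0 : EuclideanSpace ℝ (Fin 4)) 1) h0 (slideInner b r 1 (tubeArcPt θ s)).2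
  else tubeJunkPt

/-- The glued framing arc stays off the attaching sphere. [folklore] -/
theorem lamSq_slideArcPt_ne_one (b : Bool) (r : ℝ) (θ : sphere (0 : EuclideanSpace ℝ (Fin 2)) 1) (s : ℝ) :
    lamSq 2 (((slideArcPt b r θ s : ↥(handleTube 3 2)) : closedBall (0 : EuclideanSpace ℝ (Fin 4)) 1) :
      EuclideanSpace ℝ (Fin 4)) ≠ 1 := by
  unfold slideArcPt
  split_ifs with h0
  · exact (handleInversion_mem h0 (slideInner b r 1 (tubeArcPt θ s)).2).2.2
  · rw [lamSq_tubeJunkPt]; norm_num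

/-- Where the slid arc is off the belt disc, the glued arc is `α` of it … [folklore] -/
theorem coe_coe_slideArcPt (b : Bool) (r : ℝ) (θ : sphere (0 : EuclideanSpace ℝ (Fin 2)) 1) {s : ℝ}
    (h0 : lamSq 2 (((slideInner b r 1 (tubeArcPt θ s) : ↥(beltPiece 3 2)) :
      closedBall (0 : EuclideanSpace ℝ (Fin 4)) 1) : EuclideanSpace ℝ (Fin 4)) ≠ 0) :
    (((slideArcPt b r θ s : ↥(handleTube 3 2)) : closedBall (0 : EuclideanSpace ℝ (Fin 4)) 1) :
      EuclideanSpace ℝ (Fin 4)) =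
      handleInversion 2 (((slideInner b r 1 (tubeArcPt θ s) : ↥(beltPiece 3 2)) :
        closedBall (0 : EuclideanSpace ℝ (Fin 4)) 1) : EuclideanSpace ℝ (Fin 4)) := by
  rw [slideArcPt, dif_pos h0]; rfl

/-- … explicitly `α (R_{arcsin r} (σ (cos s θ, sin s, 0)))` near `s = 0` (`cos² s > 7/8`). [folklore] -/
theorem coe_coe_slideArcPt_of_lt (b : Bool) (r : ℝ) (θ : sphere (0 : EuclideanSpace ℝ (Fin 2)) 1) {s : ℝ}
    (hs : 7 / 8 < Real.cos s ^ 2) (hc : 0 < Real.cos s)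
    (h0 : lamSq 2 (((slideInner b r 1 (tubeArcPt θ s) : ↥(beltPiece 3 2)) :
      closedBall (0 : EuclideanSpace ℝ (Fin 4)) 1) : EuclideanSpace ℝ (Fin 4)) ≠ 0) :
    (((slideArcPt b r θ s : ↥(handleTube 3 2)) : closedBall (0 : EuclideanSpace ℝ (Fin 4)) 1) :
      EuclideanSpace ℝ (Fin 4)) = handleInversion 2 (slideFun b (slideAngle r 1) (swapIso (tubeArc θ s))) := by
  have hy : 7 / 8 < lamSq 2 (((tubeArcPt θ s : ↥(handleTube 3 2)) : closedBall (0 : EuclideanSpace ℝ (Fin 4)) 1) :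
      EuclideanSpace ℝ (Fin 4)) := by
    show 7 / 8 < lamSq 2 (tubeVec (tubeArcPt θ s))
    rwa [tubeVec_tubeArcPt hc, lamSq_tubeArc]
  rw [coe_coe_slideArcPt b r θ h0, coe_coe_slideInner_of_lt b r 1 hy]
  show handleInversion 2 (slideFun b (slideAngle r 1) (swapIso (tubeVec (tubeArcPt θ s)))) = _
  rw [tubeVec_tubeArcPt hc]

/-- **The glued framing arc starts at the `r`-longitude point** (`0 < r ≤ 1/2`). [folklore] -/
theorem slideArcPt_zero (b : Bool) {r : ℝ} (h0 : 0 < r) (h1 : r ≤ 1 / 2) (θ : sphere (0 : EuclideanSpace ℝ (Fin 2)) 1) :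
    slideArcPt b r θ 0 = tubeLongitudePt b r θ := by
  have hr : r ^ 2 < 1 := by nlinarith
  have hl0 : 0 < lamSq 2 (tubeLongitudeVec b r θ) := by rw [lamSq_tubeLongitudeVec b hr.le]; linarith
  have hl1 : lamSq 2 (tubeLongitudeVec b r θ) < 1 := by rw [lamSq_tubeLongitudeVec b hr.le]; nlinarith
  have key : (((slideInner b r 1 (tubeArcPt θ 0) : ↥(beltPiece 3 2)) :
      closedBall (0 : EuclideanSpace ℝ (Fin 4)) 1) : EuclideanSpace ℝ (Fin 4)) =
      handleInversion 2 (tubeLongitudeVec b r θ) := by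
    rw [tubeArcPt_zero, ← handleInversion_tubeLongitudePt b h0 h1, coe_coe_tubeLongitudePt b hr]
  have hne : lamSq 2 (((slideInner b r 1 (tubeArcPt θ 0) : ↥(beltPiece 3 2)) :
      closedBall (0 : EuclideanSpace ℝ (Fin 4)) 1) : EuclideanSpace ℝ (Fin 4)) ≠ 0 := by
    rw [key, lamSq_handleInversion hl0 hl1.le]; linarith
  apply Subtype.ext; apply Subtype.ext
  rw [coe_coe_slideArcPt b r θ hne, key, handleInversion_handleInversion hl0 hl1, coe_coe_tubeLongitudePt b hr]

/-- Near `s = 0` the slid framing arc stays off the belt disc (`0 < r ≤ 1/2`). [folklore] -/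
theorem eventually_lamSq_slideInner_tubeArcPt_ne_zero (b : Bool) {r : ℝ} (h0 : 0 < r) (h1 : r ≤ 1 / 2)
    (θ : sphere (0 : EuclideanSpace ℝ (Fin 2)) 1) :
    ∀ᶠ s in 𝓝 (0 : ℝ), lamSq 2 (((slideInner b r 1 (tubeArcPt θ s) : ↥(beltPiece 3 2)) :
      closedBall (0 : EuclideanSpace ℝ (Fin 4)) 1) : EuclideanSpace ℝ (Fin 4)) ≠ 0 := by
  have hc : ContinuousAt (fun s : ℝ => lamSq 2 (((slideInner b r 1 (tubeArcPt θ s) : ↥(beltPiece 3 2)) :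
      closedBall (0 : EuclideanSpace ℝ (Fin 4)) 1) : EuclideanSpace ℝ (Fin 4))) 0 := by
    refine ((continuous_lamSq 2).comp (continuous_subtype_val.comp (continuous_subtype_val.comp
      (contMDiff_slideInner b r 1).continuous))).continuousAt.comp ?_
    exact (contMDiffAt_tubeArcPt (by rw [Real.cos_zero]; exact one_pos)).continuousAt
  have h0' : lamSq 2 (((slideInner b r 1 (tubeArcPt θ 0) : ↥(beltPiece 3 2)) :
      closedBall (0 : EuclideanSpace ℝ (Fin 4)) 1) : EuclideanSpace ℝ (Fin 4)) ≠ 0 := by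
    rw [tubeArcPt_zero, coe_coe_slideInner_coreTubePt, lamSq_two_fin_four, sin_slideAngle_one h0.le h1]
    have hs := slideSign_sq b
    have hθ : (θ : EuclideanSpace ℝ (Fin 2)) 0 ^ 2 + (θ : EuclideanSpace ℝ (Fin 2)) 1 ^ 2 = 1 := by
      have h2 : ‖(θ : EuclideanSpace ℝ (Fin 2))‖ ^ 2 = 1 := by rw [norm_eq_of_mem_sphere θ, one_pow]
      rwa [EuclideanSpace.real_norm_sq_eq, Fin.sum_univ_two] at h2
    simp
    intro h
    have e : (r * (θ : EuclideanSpace ℝ (Fin 2)) 0) ^ 2 + (slideSign b * r * (θ : EuclideanSpace ℝ (Fin 2)) 1) ^ 2 =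
        r ^ 2 := by
      linear_combination (r ^ 2) * hθ + (r ^ 2 * (θ : EuclideanSpace ℝ (Fin 2)) 1 ^ 2) * hs
    rw [e] at h
    exact h0.ne' (by nlinarith)
  exact hc.eventually_ne h0'

variable {ι : Type*} [Finite ι] {M : Type*} [TopologicalSpace M] [T2Space M]
  [ChartedSpace (EuclideanHalfSpace 4) M] {h : ι → HandleAttachingMap 3 2 M}
  {P : Type*} [TopologicalSpace P] [ChartedSpace (EuclideanHalfSpace 4) P]
  (D : MultiAttachmentData h (𝓡∂ 4) P) (i : ι) (b : Bool)

/-- **The slid framing arc is glued to `h̄ᵢ` of the glued framing arc** (off the belt disc).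
[cite: Kosinski1993, VI §6] -/
theorem jB_slideInner_tubeArcPt (r : ℝ) (θ : sphere (0 : EuclideanSpace ℝ (Fin 2)) 1) {s : ℝ}
    (h0 : lamSq 2 (((slideInner b r 1 (tubeArcPt θ s) : ↥(beltPiece 3 2)) :
      closedBall (0 : EuclideanSpace ℝ (Fin 4)) 1) : EuclideanSpace ℝ (Fin 4)) ≠ 0) :
    D.jB i (slideInner b r 1 (tubeArcPt θ s)) =
      D.jA ⟨(h i).toFun (slideArcPt b r θ s), BeltPageClause.apply_mem_coresComplement_of_lamSq_ne_one
        D.disjoint i _ (lamSq_slideArcPt_ne_one b r θ s)⟩ := by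
  set x := slideInner b r 1 (tubeArcPt θ s) with hx
  have h1 : lamSq 2 (((x : ↥(beltPiece 3 2)) : closedBall (0 : EuclideanSpace ℝ (Fin 4)) 1) :
      EuclideanSpace ℝ (Fin 4)) ≠ 1 := x.2
  have h0' : 0 < lamSq 2 (((x : ↥(beltPiece 3 2)) : closedBall (0 : EuclideanSpace ℝ (Fin 4)) 1) :
      EuclideanSpace ℝ (Fin 4)) := lt_of_le_of_ne (lamSq_nonneg 2 _) (Ne.symm h0)
  have h1' : lamSq 2 (((x : ↥(beltPiece 3 2)) : closedBall (0 : EuclideanSpace ℝ (Fin 4)) 1) :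
      EuclideanSpace ℝ (Fin 4)) < 1 := lt_of_le_of_ne (lamSq_le_one (mem_closedBall_zero_iff.1 x.1.2)) h1
  rw [BeltPageClause.jA_apply_eq_jB D i _ (lamSq_slideArcPt_ne_one b r θ s)]
  congr 1
  apply Subtype.ext; apply Subtype.ext
  show _ = handleInversion 2 _
  rw [coe_coe_slideArcPt b r θ h0, handleInversion_handleInversion h0' h1']

/-- **The end framing of the slide is the velocity of the glued framing arc on the base piece**:
`ν₁(θ) = d/ds|₀ D.jA (h̄ᵢ (slideArcPt θ s))` (`0 < r ≤ 1/2`). [cite: Kirby1989, Ch. I §2] -/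
theorem attachingFraming_slideMap_one {r : ℝ} (h0 : 0 < r) (h1 : r ≤ 1 / 2)
    (θ : sphere (0 : EuclideanSpace ℝ (Fin 2)) 1) :
    (slideMap D i b r 1).attachingFraming θ =
      mfderiv 𝓘(ℝ, ℝ) (𝓡∂ 4) (fun s => D.jA ⟨(h i).toFun (slideArcPt b r θ s),
        BeltPageClause.apply_mem_coresComplement_of_lamSq_ne_one D.disjoint i _
          (lamSq_slideArcPt_ne_one b r θ s)⟩) 0 (1 : ℝ) := by
  rw [Literature.Geometry.Symplectic.attachingFraming_eq_mfderiv_comp_tubeArcPt]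
  congr 1
  refine Filter.EventuallyEq.mfderiv_eq ?_
  filter_upwards [eventually_lamSq_slideInner_tubeArcPt_ne_zero b h0 h1 θ] with s hs
  exact jB_slideInner_tubeArcPt D i b r θ hs


/-- Near `s = 0` the glued framing arc is `α (R_{arcsin r} (σ (cos s θ, sin s, 0)))` explicitly
(`0 < r ≤ 1/2`). [folklore] -/
theorem eventually_coe_coe_slideArcPt {r : ℝ} (h0 : 0 < r) (h1 : r ≤ 1 / 2)
    (θ : sphere (0 : EuclideanSpace ℝ (Fin 2)) 1) :
    ∀ᶠ s in 𝓝 (0 : ℝ), (((slideArcPt b r θ s : ↥(handleTube 3 2)) : closedBall (0 : EuclideanSpace ℝ (Fin 4)) 1) :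
      EuclideanSpace ℝ (Fin 4)) =
      handleInversion 2 (WithLp.toLp 2
        ![Real.sqrt (1 - r ^ 2) * Real.sin s + r * Real.cos s * (θ : EuclideanSpace ℝ (Fin 2)) 0,
          slideSign b * r * Real.cos s * (θ : EuclideanSpace ℝ (Fin 2)) 1,
          -r * Real.sin s + Real.sqrt (1 - r ^ 2) * Real.cos s * (θ : EuclideanSpace ℝ (Fin 2)) 0,
          Real.sqrt (1 - r ^ 2) * Real.cos s * (θ : EuclideanSpace ℝ (Fin 2)) 1]) := by
  have hcos : ∀ᶠ s in 𝓝 (0 : ℝ), 7 / 8 < Real.cos s ^ 2 :=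
    (Real.continuous_cos.pow 2).continuousAt.eventually (eventually_gt_nhds (by norm_num [Real.cos_zero]))
  filter_upwards [hcos, eventually_cos_pos, eventually_lamSq_slideInner_tubeArcPt_ne_zero b h0 h1 θ] with s hs hc hne
  rw [coe_coe_slideArcPt_of_lt b r θ hs hc hne]
  have es := sin_slideAngle_one h0.le h1
  have ec := cos_slideAngle_one h0.le h1
  congr 1
  ext i
  fin_cases i <;> simp [tubeArc, corePt, es, ec] <;> ring

end Arc

/-! ### §7 Registered helper -/

/-- **Registered helper `helper_belt_slide` (stage 1–2 of node T3c-1 `node_belt_isotopic_pushoff`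
of NF6 `stub_steinRealisation`, wave 2, lead c5): in `∂P`, the framed BELT circles of a
multi-attachment `P = M ∪_{h̄} (handles)` are link-isotopic, each inside its own handle, to the
`D.jA ∘ h̄ᵢ`-images of the `r`-LONGITUDES `(√(1-r²) θ, ±√(1-r²) θ̄₁…, r θ)` of the attaching
circles (Kosinski's identification `x ∼ h̄ α(x)` read on the torus of radius `r`), the belt
framings being carried by the handle framings of the slid belt maps; the end framing is the
velocity of `D.jA ∘ h̄ᵢ` along an explicit model arc.**  Per handle a direction `b i` (longitude
`x_λ ∥ x_μ` or `x_λ ∥ x̄_μ`) and a radius `0 < r i ≤ 1/2`. [cite: Kosinski1993, VI §6] -/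
theorem helper_belt_slide :
    ∀ {ι : Type} [Finite ι] {M : Type} [TopologicalSpace M] [T2Space M]
      [ChartedSpace (EuclideanHalfSpace 4) M]
      {h : ι → Literature.Topology.FourManifolds.HandleAttachingMap 3 2 M}
      {P : Type} [TopologicalSpace P] [T2Space P] [ChartedSpace (EuclideanHalfSpace 4) P]
      [IsManifold (𝓡∂ 4) ∞ P]
      (D : Literature.Topology.FourManifolds.HandleAttachingMap.MultiAttachmentData h (𝓡∂ 4) P)
      (b : ι → Bool) (r : ι → ℝ), (∀ i, 0 < r i) → (∀ i, r i ≤ 1 / 2) →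
      ∃ (q : ι → ℝ → Literature.Topology.FourManifolds.HandleAttachingMap 3 2 P)
        (y : ι → Metric.sphere (0 : EuclideanSpace ℝ (Fin 2)) 1 →
          ↥(Literature.Topology.FourManifolds.handleTube 3 2))
        (Y : ι → Metric.sphere (0 : EuclideanSpace ℝ (Fin 2)) 1 → ℝ →
          ↥(Literature.Topology.FourManifolds.handleTube 3 2))
        (hy : ∀ i θ, (h i).toFun (y i θ) ∈
          Literature.Topology.FourManifolds.HandleAttachingMap.coresComplement h)
        (hY : ∀ i θ s, (h i).toFun (Y i θ s) ∈
          Literature.Topology.FourManifolds.HandleAttachingMap.coresComplement h)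
        (Φ : Literature.Geometry.Symplectic.LinkIsotopyInBoundary
          (fun i => (Summit.SmoothPoincare4.SmoothPoincare4.Theorems.AcyclicBisectionExists.ModpBraidOrbits.beltMap
            D i).attachingCircle)
          (fun i θ => D.jA ⟨(h i).toFun (y i θ), hy i θ⟩)),
        (∀ i t, (Φ.isotopy i).toFun t = (q i t).attachingCircle) ∧
        (∀ i, Literature.Geometry.Symplectic.IsFramingAlong (Φ.isotopy i)
          (Summit.SmoothPoincare4.SmoothPoincare4.Theorems.AcyclicBisectionExists.ModpBraidOrbits.beltMap
            D i).attachingFraming fun t => (q i t).attachingFraming) ∧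
        (∀ i t, Set.range (q i t).toFun ⊆ Set.range (D.jB i)) ∧
        (∀ i θ, (((y i θ : ↥(Literature.Topology.FourManifolds.handleTube 3 2)) :
            Metric.closedBall (0 : EuclideanSpace ℝ (Fin 4)) 1) : EuclideanSpace ℝ (Fin 4)) =
          WithLp.toLp 2 ![Real.sqrt (1 - r i ^ 2) * (θ : EuclideanSpace ℝ (Fin 2)) 0,
            (if b i then -1 else 1) * Real.sqrt (1 - r i ^ 2) * (θ : EuclideanSpace ℝ (Fin 2)) 1,
            r i * (θ : EuclideanSpace ℝ (Fin 2)) 0, r i * (θ : EuclideanSpace ℝ (Fin 2)) 1]) ∧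
        (∀ i θ, Y i θ 0 = y i θ) ∧
        (∀ i θ, ∀ᶠ s in nhds (0 : ℝ), (((Y i θ s : ↥(Literature.Topology.FourManifolds.handleTube 3 2)) :
            Metric.closedBall (0 : EuclideanSpace ℝ (Fin 4)) 1) : EuclideanSpace ℝ (Fin 4)) =
          Literature.Topology.FourManifolds.handleInversion 2 (WithLp.toLp 2
            ![Real.sqrt (1 - r i ^ 2) * Real.sin s + r i * Real.cos s * (θ : EuclideanSpace ℝ (Fin 2)) 0,
              (if b i then -1 else 1) * r i * Real.cos s * (θ : EuclideanSpace ℝ (Fin 2)) 1,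
              -r i * Real.sin s + Real.sqrt (1 - r i ^ 2) * Real.cos s * (θ : EuclideanSpace ℝ (Fin 2)) 0,
              Real.sqrt (1 - r i ^ 2) * Real.cos s * (θ : EuclideanSpace ℝ (Fin 2)) 1])) ∧
        (∀ i θ, (q i 1).attachingFraming θ =
          mfderiv 𝓘(ℝ, ℝ) (𝓡∂ 4) (fun s => D.jA ⟨(h i).toFun (Y i θ s), hY i θ s⟩) 0 (1 : ℝ)) := by
  intro ι _ M _ _ _ h P _ _ _ _ D b r hr0 hr1
  have hsq : ∀ i, r i ^ 2 < 1 := fun i => by nlinarith [hr0 i, hr1 i]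
  -- the end knots, as functions, in the `D.jA` form
  have key : ∀ (L' : ι → sphere (0 : EuclideanSpace ℝ (Fin 2)) 1 → P)
      (_ : (fun i => (slideMap D i (b i) (r i) 1).attachingCircle) = L'),
      ∃ Φ : Literature.Geometry.Symplectic.LinkIsotopyInBoundary (fun i => (beltMap D i).attachingCircle) L',
        (∀ i t, (Φ.isotopy i).toFun t = (slideMap D i (b i) (r i) t).attachingCircle) ∧
        ∀ i, Literature.Geometry.Symplectic.IsFramingAlong (Φ.isotopy i) (beltMap D i).attachingFraming
          fun t => (slideMap D i (b i) (r i) t).attachingFraming := by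
    intro L' e
    subst e
    exact ⟨slideLinkIsotopy D b r, fun i t => rfl, fun i => isFramingAlong_slide D i (b i) (r i)⟩
  obtain ⟨Φ, hΦ, hfr⟩ := key (fun i θ => D.jA ⟨(h i).toFun (tubeLongitudePt (b i) (r i) θ),
    BeltPageClause.apply_mem_coresComplement_of_lamSq_ne_one D.disjoint i _
      (lamSq_tubeLongitudePt_ne_one (b i) (hr0 i).ne' (hsq i) θ)⟩)
    (funext fun i => funext fun θ => attachingCircle_slideMap_one D i (b i) (hr0 i) (hr1 i) θ)
  refine ⟨fun i t => slideMap D i (b i) (r i) t, fun i θ => tubeLongitudePt (b i) (r i) θ,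
    fun i θ s => slideArcPt (b i) (r i) θ s, _, fun i θ s =>
      BeltPageClause.apply_mem_coresComplement_of_lamSq_ne_one D.disjoint i _
        (lamSq_slideArcPt_ne_one (b i) (r i) θ s),
    Φ, hΦ, hfr, fun i t => range_slideMap_subset D i (b i) (r i) t, fun i θ => ?_,
    fun i θ => slideArcPt_zero (b i) (hr0 i) (hr1 i) θ, fun i θ => ?_,
    fun i θ => attachingFraming_slideMap_one D i (b i) (hr0 i) (hr1 i) θ⟩
  · rw [coe_coe_tubeLongitudePt (b i) (hsq i)]; rfl
  · exact eventually_coe_coe_slideArcPt (b i) (hr0 i) (hr1 i) θ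


end Summit.SmoothPoincare4.SmoothPoincare4.Theorems.AcyclicBisectionExists.ModpBraidOrbits

end
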